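import Summits.ABC.IUTFork.Joshi.GeometricCaseBridge
import Summits.ABC.IUTFork.Joshi.GeometricCase1Theta

/-!
# Joshi's geometric case — bridge, complex side: the Schottky parameters of §12.12's `Θ^val_classical` (T-36, p430006) ARE
# T-35's `q_{τ,j}` of Thm. 12.8.5 (3) (`Geo.schottkyTuple`) — proof-only, no side taken

Record file of the abc-iut cell, branch E (rung LADDER-ABC:A2.E; seat abc-iut-E-t36, slot T-36; last merge-debt of p430006 per
plan/E/ASSIGNMENTS.md §4 item 4). `Joshi/GeometricCase2.lean` restated MINIMALLY the Schottky parameter `q_{τ,j} = e^{2π√−1·j²τ/2ℓ}`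
of `E_{τ,j} = E_{τ/2ℓ, j²}` ([J-III] arXiv:2401.13508 v4, §12.8 convention p. 149 l. 34–37, Def. 12.7.2, Thm. 12.8.5 (3)) as
`GeoLocus.HeightDatum.schottkyParam` in order to type §12.12's theta-values set `Θ^val_classical`; T-35 (abc-iut-E-t35) has since
typed it as `Geo.schottkyTuple L τ j = schottky (tauPt L τ j)` (`Joshi/GeometricCase1Theta.lean`) with `q_{τ,j} = q̈^{j²}`
(`Geo.schottkyTuple_eq_pow`). DERIVED here, over the bridge `GeoLocus.HeightDatum.ofCover` (p432141): the two AGREE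
(`coe_schottkyParam_ofCover`), hence `q_{τ,j} = q̈^{j²}` for the §12.12 parameters (`coe_schottkyParam_ofCover_eq_pow`), and
§12.12's `Θ^val_classical` consists exactly of the [Deligne]-images of T-35's Schottky tuples at the periods `τ_s`
(`mem_thetaValClassical_ofCover_iff`). With this file no object of §§12.3–12.8 remains restated un-bridged in the §§12.9–12.18
typing. Typed ≠ proved ≠ endorsed; unrefereed source, disputed in print (`Mochizuki2024JoshiReport`); nothing here bears on
[IUTchIII] Cor. 3.12 or abc. [claim: Joshi2024ATS3, status: disputed]
-/

noncomputable section

open scoped MatrixGroups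

namespace Summit.ABC.IUTFork.Joshi.ATS3.GeoLocus

open Summit.ABC.IUTFork.Joshi.ATS3.Geo

namespace HeightDatum

variable {Y : Type} [Group Y] (D : CoverSL2R Y) (L : Level) (h : Y → ℝ)

/-- The §12.12 Schottky parameter of p430006 at the bridged signature IS T-35's `q_{τ,j}` (Thm. 12.8.5 (3)):
`e^{2π√−1·(j+1)²τ/2ℓ} = schottky(j²τ/2ℓ)` — same number, two typings. [folklore] -/
theorem coe_schottkyParam_ofCover (τ : UpperHalfPlane) (j : Fin L.lstar) :
    (((ofCover D L h).schottkyParam τ j : ℂˣ) : ℂ) = schottkyTuple L τ j := by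
  rw [schottkyTuple_eq, schottkyParam, Units.val_mk0, ofCover_ell]
  congr 1
  have hℓ : (L.ell : ℂ) ≠ 0 := by exact_mod_cast L.ell_pos.ne'
  rw [Level.jOf]
  push_cast
  field_simp

/-- Hence `q_{τ,j} = q̈^{j²}` (`q̈ = q^{1/2ℓ}`, T-35's `Geo.qRoot`) for the §12.12 parameters — an INTEGER power, no branch choice.
[folklore] -/
theorem coe_schottkyParam_ofCover_eq_pow (τ : UpperHalfPlane) (j : Fin L.lstar) :
    (((ofCover D L h).schottkyParam τ j : ℂˣ) : ℂ) = qRoot L τ ^ (L.jOf j ^ 2) := by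
  rw [coe_schottkyParam_ofCover, schottkyTuple_eq_pow]

/-- §12.12 through the bridge: `x ∈ Θ^val_classical` iff `Θ_classical ≠ ∅` and, for some singular point `s`, the [Deligne]
identification `Ext¹_{ℤ-MHS}(ℤ(0),ℤ(1)) ≃ ℂ*` sends `x_j` to T-35's `q_{τ_s,j}` for every `j` («by taking the tuples of Schottky
parameters provided by each tuple … ∈ Θ_classical», p. 153 l. 43–50; Lemma 12.10.2). [folklore] -/
theorem mem_thetaValClassical_ofCover_iff {Ext1 : Type} (H : SchottkyHodgeDatum Ext1) {n : ℕ}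
    (τs : Fin n → UpperHalfPlane) (x : Fin L.lstar → Ext1) :
    x ∈ (ofCover D L h).thetaValClassical H τs ↔
      ((ofCover D L h).thetaClassical τs).Nonempty ∧ ∃ s : Fin n, ∀ j, ((H.deligne (x j) : ℂˣ) : ℂ) = schottkyTuple L (τs s) j := by
  constructor
  · rintro ⟨hne, s, rfl⟩
    refine ⟨hne, s, fun j => ?_⟩
    rw [SchottkyHodgeDatum.deligne_schottkyTuple, coe_schottkyParam_ofCover]
  · rintro ⟨hne, s, hs⟩
    refine ⟨hne, s, funext fun j => ?_⟩
    apply H.deligne.injective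
    rw [SchottkyHodgeDatum.deligne_schottkyTuple]
    exact Units.ext ((hs j).trans (coe_schottkyParam_ofCover D L h (τs s) j).symm)

end HeightDatum

end Summit.ABC.IUTFork.Joshi.ATS3.GeoLocus
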